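import Summits.CriticalPhenomena.PercolationContinuityZ3.Theorems.FK.Transplant.KNFreeCorridorMatrix
import Summits.CriticalPhenomena.PercolationContinuityZ3.Theorems.FK.Transplant.KNFreeOrigin
import Summits.CriticalPhenomena.PercolationContinuityZ3.Theorems.FK.Transplant.KNFreeBad
import HarnessLib

/-!
# FRONTIER TRANSPLANT: the record's conclusion `∃ r, UFSC0 d q p r ε₀` from TARGET MATRICES — the two instances
# of binder 2 that Kozma–Nitzan's Theorem-6 constants actually consume (quarter faces; elongated faces, uniformly
# in the aspect) plus ONE free look (the aspect-6 elongated geometries), for every `q ≥ 1`, `d ≥ 3`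

Support file (`--supports stmt-CriticalPhenomena-4575`, helper) of the FRONTIER TRANSPLANT sub-cell
(`fk-continuity/transplant/`, seat `prim-bschramm-fkt-p3`); builds on p205010 (kernel theorem, internal audit signed;
external expert review pending). No definitions, no named facts, no sorries; standard axioms.
Registered R62 (cell INBOX l.4588, 2026-08-23); registry row T2s; lead label T2s-C (fkt-lead L21, l.4604). Convergent independent scratch: fkt-p4 g154 (`transplant/prim-bschramm-fkt-p4-g154/`, cell INBOX l.4537; NO CONTEST l.4574).

HONEST FRAMING (page 1, cell rule). The transplant's theorem of record `ufsc0_of_freeBoundaryHypothesis_r3`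
(p248245, END STATE « 2 / 0 ☑ ») is CONDITIONAL on FH AND on TP_FK = `KNFreeTargetHittable d q p`, both OPEN at
the same `p` for `q > 1` near `p_c(q)` (⇔ GRC Conj. (5.103) via K1; barrier note
`Literature.Barriers.CriticalPhenomena.SamePFreeBoundaryCriteria`, FBN-01, cited first); the transplant is a typed
reduction, not a proof of FK continuity, and THIS FILE DOES NOT CHANGE THAT. It is the MATRIX-LEVEL ASSEMBLY of the
record's conclusion: T3w's `ufsc0_window` (`UFSC0BernoulliWindow.lean`) with the window target lemma abstracted into
the two target matrices it feeds to KN's constants (in the way `KNFreeCorridorMatrix.lean` abstracted Lemma 12).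
NOT `KNFreeTargetHittable`, NOT a binder discharge, NOT `_r4`; nothing at `p ↓ p_c(q)`; `_r3` « 2 / 0 ☑ »,
n_open = 2, BINDER-OWNERS, FO-19 NO-GO unchanged.

* `ufsc0_of_targetMatrices (hd : 3 ≤ d) (hq : 1 ≤ q) (hε₀ : 0 < ε₀) (p)
    (hTq : ∀ ε > 0, ∃ δ > 0, ∃ R, FKTargetAt d q p δ ε (qfList d) R)
    (hTe : ∀ ε > 0, ∃ δ > 0, ∀ K ≥ 2, ∃ R, FKTargetAt d q p δ ε (elongList d K) R)
    (hel6 : ∀ g ∈ elongList d 6, IsHittableFK q p g) : ∃ r, UFSC0 d q p r ε₀` —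
  KN's Theorem-6 constants (pp. 25–26) run on: Lemma 12-FK from the matrices for `qfList d` and `elongList d 88`
  (`fkCorridorRestrAt_of_fkTargetAt`, T3m); the matrix for `elongList d (2K)` at the tolerance `δ₂(δ_c)` obtained
  BEFORE `K` is chosen (so `δ` uniform in the aspect `K` is the load-bearing quantifier of `hTe`); (32) at the
  origin from one free look of the aspect-`6` geometry (row 5 `knFreeOriginLook`, landed) — the ONLY place
  FK-hittability itself enters; (33) per direction (row 6 `knFreeBadRestr`, landed).

Every closed form of the conclusion in the tree or in the registry is an instance: the record `_r3` (matrices from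
TP_FK ∧ FH via rows 3–4), T3w (matrices from the window target lemma T2w for `P_{p̃}`-hittable families, `hel6` by
T1's comparison), T2-HD (high density), and the MEMO row T4-SLAB (R60: matrices for the codimension-1 axis-box class
from `Π(p, L)` — its package (P6) `ufsc0_of_fkSlabPercolation` is this theorem applied to (P4) and (P5) at `K = 6`).

References: G. Kozma, S. Nitzan, arXiv:2401.12397 (2024), §4 Theorem 6 (pp. 25–26), Lemmas 10–12 [KozmaNitzan2024];
G. Grimmett, *The Random-Cluster Model*, Springer 2006, Thm. (3.7), eq. (3.22), Conj. (5.103) [Grimmett2006].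
-/

noncomputable section

open MeasureTheory
open scoped ENNReal Classical

namespace Summit.CriticalPhenomena.PercolationContinuityZ3.Theorems.FK

open Literature.Probability.Percolation Literature.Probability.LatticeModels
open Literature.Probability.Percolation.GadgetSystem Literature.Probability.Percolation.KozmaNitzan

variable {d : ℕ}

/-- **The record's conclusion from target matrices.** For `3 ≤ d`, `1 ≤ q`, `0 < ε₀` and any `p`: if the FK target
inequality `FKTargetAt d q p δ ε H R` is available (`∀ ε ∃ δ ∃ R`) for the quarter faces `H = qfList d` and, with `δ`
UNIFORM in the aspect `K ≥ 2`, for the elongated faces `H = elongList d K`, and if the aspect-`6` elongated geometries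
are FK-hittable at `(q, p)`, then `∃ r, UFSC0 d q p r ε₀`. Proof: T3w's run of KN's Theorem-6 constants verbatim —
Lemma 12-FK at `ε₀/2` from the two matrices (`fkCorridorRestrAt_of_fkTargetAt`), `δ_c = min δ ½`, the elongated matrix
at `δ_c` giving `δ₂` before `K` is fixed by `(1-δ₂')^K ≤ ε₀/2`, `R` for `elongList d (2K)`, the scale
`s = max(1, 2R, m, look thresholds of the six aspect-6 looks at δ_c)`, `r = K·s`; then (32) at the origin by row 5
and (33) per direction by row 6. [cite: KozmaNitzan2024, §4 Theorem 6 (pp. 25–26, the constants), Lemma 12 (pp. 23–25); Grimmett2006, Conj. (5.103)] -/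
theorem ufsc0_of_targetMatrices (hd : 3 ≤ d) {q : ℝ} {ε₀ : ℝ} (hq : 1 ≤ q) (hε₀ : 0 < ε₀) (p : unitInterval)
    (hTq : ∀ ⦃ε : ℝ⦄, 0 < ε → ∃ δ : ℝ, 0 < δ ∧ ∃ R₀ : ℕ, FKTargetAt d q p δ ε (qfList d) R₀)
    (hTe : ∀ ⦃ε : ℝ⦄, 0 < ε → ∃ δ : ℝ, 0 < δ ∧ ∀ (K : ℕ) (hK : 2 ≤ K),
      ∃ R₀ : ℕ, FKTargetAt d q p δ ε (elongList d K (by omega)) R₀)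
    (hel6 : ∀ g ∈ elongList d 6 (by norm_num), IsHittableFK q p g) :
    ∃ r : ℕ, UFSC0 d q p r ε₀ := by
  haveI : NeZero d := ⟨by omega⟩
  -- the matrix for `elongList d 88` (Lemma 12's corridor step)
  have hTe88 : ∀ ⦃ε : ℝ⦄, 0 < ε → ∃ δ : ℝ, 0 < δ ∧ ∃ R₀ : ℕ,
      FKTargetAt d q p δ ε (elongList d 88 (by norm_num)) R₀ := by
    intro ε hε
    obtain ⟨δ, hδ, hH⟩ := hTe hε
    obtain ⟨R₀, hR₀⟩ := hH 88 (by norm_num)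
    exact ⟨δ, hδ, R₀, hR₀⟩
  -- Lemma 12-FK at `ε₀ / 2`, from the matrices
  obtain ⟨δ, hδ0, m, hcorr⟩ := fkCorridorRestrAt_of_fkTargetAt hq p hTq hTe88 (half_pos hε₀)
  set δc : ℝ := min δ (1 / 2) with hδc
  have hδc0 : 0 < δc := lt_min hδ0 (by norm_num)
  have hδc1 : δc ≤ 1 := (min_le_right _ _).trans (by norm_num)
  have hδcδ : δc ≤ δ := min_le_left _ _
  -- the elongated matrix at `δc`: `δ₂` BEFORE `K`
  obtain ⟨δ₂, hδ₂0, htgt0⟩ := hTe hδc0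
  set δ₂' : ℝ := min δ₂ 1 with hδ₂'
  have hδ₂'0 : 0 < δ₂' := lt_min hδ₂0 one_pos
  have hδ₂'1 : δ₂' ≤ 1 := min_le_right _ _
  have hδ₂'2 : δ₂' ≤ δ₂ := min_le_left _ _
  -- `K`
  obtain ⟨K₀, hK₀⟩ := exists_pow_lt_of_lt_one (half_pos hε₀) (show 1 - δ₂' < 1 by linarith)
  set K : ℕ := max K₀ 20 with hK
  have hK20 : 20 ≤ K := le_max_right _ _
  have hKε : (1 - δ₂') ^ K + ε₀ / 2 ≤ ε₀ := by
    have : (1 - δ₂') ^ K ≤ (1 - δ₂') ^ K₀ :=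
      pow_le_pow_of_le_one (by linarith) (by linarith) (le_max_left _ _)
    linarith
  -- `R`, for the family `elongList d (2K)`
  have hK2 : 2 ≤ 2 * K := by omega
  obtain ⟨R, hR⟩ := htgt0 (2 * K) hK2
  -- the look thresholds of the aspect-`6` geometries for (32) at the origin
  set C₀ : Cells d := ⟨hd, 20, 1, le_rfl, le_rfl⟩ with hC₀
  have hhit6 : ∀ du : MDir, ∃ kℓ : ℕ, ∀ m', kℓ ≤ m' → ∀ ℓ, kℓ ≤ ℓ →
      FKLookAt q p (elongGeom (C₀.axOf du) (σu du) 6 (by norm_num)) δc m' ℓ := by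
    intro du
    have hg : elongGeom (C₀.axOf du) (σu du) 6 (by norm_num) ∈ elongList d 6 (by norm_num) :=
      elongGeom_mem_elongList _ _ _ _
    obtain ⟨k, ℓ₀, h⟩ := (hel6 _ hg).hit δc hδc0
    exact ⟨max k ℓ₀, fun m' hm' ℓ hℓ => h m' ((le_max_left _ _).trans hm') ℓ ((le_max_right _ _).trans hℓ)⟩
  choose kℓ hkℓ using hhit6
  set kmax : ℕ := Finset.univ.sup kℓ with hkmax
  have hkmax' : ∀ du, kℓ du ≤ kmax := fun du => Finset.le_sup (f := kℓ) (Finset.mem_univ du)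
  -- `s` and the scheme
  set s : ℕ := max (max (max 1 (2 * R)) m) kmax with hs
  have hs1 : 1 ≤ s := le_trans (le_trans (le_max_left _ _) (le_max_left _ _)) (le_max_left _ _)
  have hsR : 2 * R ≤ s := le_trans (le_trans (le_max_right _ _) (le_max_left _ _)) (le_max_left _ _)
  have hsm : m ≤ s := le_trans (le_max_right _ _) (le_max_left _ _)
  have hsk : kmax ≤ s := le_max_right _ _
  set C : Cells d := ⟨hd, K, s, hK20, hs1⟩ with hCdef
  set S : KSch d := ⟨C, p, δc⟩ with hSdef
  have hsr : s ≤ C.r := by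
    show s ≤ K * s
    exact Nat.le_mul_of_pos_left s (by omega)
  refine ⟨C.r, S, rfl, rfl, hδc0, hδc1, fun du => ?_, fun h e du hV hdu => ?_⟩
  · -- (32) at the origin, from one free look of the aspect-`6` geometry at scale `3r` (row 5, landed)
    refine knFreeOriginLook hq p S rfl du (hkℓ du (3 * C.r) ?_ (3 * C.r) ?_) <;> linarith [hkmax' du]
  · -- (33) for one direction: Steps II–IV (row 6, landed) fed by Lemma 12-FK and the elongated matrix at `S`
    have hcorrS : FKCorridorRestrAt d q S.p S.δc (ε₀ / 2) S.C.r := by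
      intro T hT hTr hyp
      refine hcorr T hT (hsm.trans (hsr.trans hTr)) (lt_of_le_of_lt ?_ hyp)
      show 1 - δ ≤ 1 - δc
      linarith
    have htgtS : FKTargetAt d q S.p δ₂' S.δc (elongList d (2 * S.C.K) (by have := S.C.hK; omega)) R := by
      intro W Sfin D lo hi T o h1 h2 h3 h4 h5 h6 h7 h8 h9 h10
      refine hR W Sfin D lo hi T o h1 h2 h3 h4 h5 h6 h7 h8 h9 (lt_of_le_of_lt ?_ h10)
      show 1 - δ₂ ≤ 1 - δ₂'
      linarith
    calc (fkLaw (S.Sx h e du) (S.Wfull h e du) q).real (badFK S q h e du)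
        ≤ (1 - δ₂') ^ S.C.K + ε₀ / 2 := knFreeBadRestr hq p S rfl hδ₂'1 hcorrS htgtS hsR h e du hV hdu
      _ ≤ ε₀ := hKε

/-- **The record's conclusion from ONE matrix map uniform over the box families.** If a single tolerance map serves
the quarter faces and all elongated faces (`∀ ε ∃ δ`, then `∃ R` for `qfList d` and for every `elongList d K`,
`K ≥ 2`) and the aspect-`6` elongated geometries are FK-hittable, then `∃ r, UFSC0 d q p r ε₀` (`d ≥ 3`, `q ≥ 1`,
`ε₀ > 0`). The shape delivered by a class-relative binder 2 for any class containing the box families.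
[cite: KozmaNitzan2024, §4 Theorem 6 (pp. 25–26); Grimmett2006, Conj. (5.103)] -/
theorem ufsc0_of_boxTargetMatrix (hd : 3 ≤ d) {q : ℝ} {ε₀ : ℝ} (hq : 1 ≤ q) (hε₀ : 0 < ε₀) (p : unitInterval)
    (hT : ∀ ⦃ε : ℝ⦄, 0 < ε → ∃ δ : ℝ, 0 < δ ∧ (∃ R₀ : ℕ, FKTargetAt d q p δ ε (qfList d) R₀) ∧
      ∀ (K : ℕ) (hK : 2 ≤ K), ∃ R₀ : ℕ, FKTargetAt d q p δ ε (elongList d K (by omega)) R₀)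
    (hel6 : ∀ g ∈ elongList d 6 (by norm_num), IsHittableFK q p g) :
    ∃ r : ℕ, UFSC0 d q p r ε₀ :=
  ufsc0_of_targetMatrices hd hq hε₀ p
    (fun _ hε => let ⟨δ, hδ, hq', _⟩ := hT hε; ⟨δ, hδ, hq'⟩)
    (fun _ hε => let ⟨δ, hδ, _, he⟩ := hT hε; ⟨δ, hδ, he⟩) hel6

end Summit.CriticalPhenomena.PercolationContinuityZ3.Theorems.FK

end
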